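import Mathlib
import HarnessLib
import Summits.Ventures.LatticeQCDFlow.Scaling.TorusRankedMorseCount

/-!
# LatticeQCDFlow / Scaling — FREE BOUNDARY in every dimension: inside a box of `(ℤ/L)^d` the largest ranked
# one-plaquette heat-bath structure is the Morse structure cut to the box (the torus Morse plaquettes outside
# the box complete ANY ranked structure inside it)

HONEST FRAMING: exact (Metropolis-corrected) sampling algorithms for lattice gauge theory;
figures of merit are autocorrelation/cost numbers at stated couplings and volumes; no
continuum-physics claim.

Venture `LatticeQCDFlow` (cell pub-lqcd), topic `Scaling`, FANOUT row 30 (lean-1, GEN-25) — OUR WORK on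
THEORY-2.md §4 row C5.  `TorusRankedMorseCount`: on the periodic lattice `(ℤ/L)^d` the least number of
plaquettes outside a ranked structure is `(d−1)(d−2)/2·L^d + (d−1)`.  Is the torus or the dimension to
blame?  GEN-22's `AutoregressiveGaugeHeatBathExact2D`: with FREE boundary in `d = 2` nothing stays outside.
Here the free-boundary question in every dimension — the box `K` of plaquettes whose sites have all
coordinates (`.val`) below `R` (`R + 1 ≤ L`, so nothing wraps), ranked structures `B ⊆ K`:

* §1 `mem_boxLinks_of_mem_box` (the four links of a box plaquette are box links) and
  **`morse_mem_box_of_topLink`** — a torus Morse plaquette whose top link is a box link lies in the box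
  (the product matching of `TorusRankedMorseStructure` restricts to the box);
* §2 **`ranked_union_morse_outside_box`** — for every ranked `B ⊆ K`, `B ∪ (Morse ∖ K)` is ranked on the
  torus (ranks of the outside part shifted above `B`; no outside top link lies on a box plaquette);
* §3 **`card_le_card_morse_inter_box`** — hence, by the homology bound and the Morse count,
  `#B ≤ #(Morse ∩ K)` for every ranked `B ⊆ K`; the Morse structure cut to the box is itself ranked, so
  **`isGreatest_card_ranked_box`** / **`isLeast_card_compl_ranked_box`**: THE LEAST NUMBER OF BOX
  PLAQUETTES OUTSIDE A RANKED STRUCTURE INSIDE THE BOX IS EXACTLY `#(K ∖ Morse)` — counted in the sequel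
  `BoxRankedMorseCount` (`(R−1)³` in `d = 3`: one plaquette per unit cube; `0` in `d = 2`).

No `def` (box and Morse structure are explicit filter terms passed as hypotheses `hK`, `hB`, `ht`, `hr`),
no `sorry`, nothing cited as a fact beyond the tree.
-/

namespace Summit.Ventures.LatticeQCDFlow.Theory2.Autoregressive

open Finset
open Literature.MathematicalPhysics.QuantumFieldTheory

variable {d L R : ℕ} [NeZero L]

/-! ## §1 Box plaquettes, box links, and the Morse structure -/

/-- **The four links of a box plaquette are box links**: base coordinates below `R`, and the link's own
coordinate plus one below `R` (`R + 1 ≤ L`, so `val (c + 1) = val c + 1` on the box). [ours] -/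
theorem mem_boxLinks_of_mem_box (hRL : R + 1 ≤ L) (p : Plaquette d L)
    (hp : (∀ m : Fin d, (p.1 m).val < R) ∧ (p.1 p.2.1.1).val + 1 < R ∧ (p.1 p.2.1.2).val + 1 < R)
    {e : Edge d L}
    (he : e ∈ ({(p.1, p.2.1.1), (p.1.shift p.2.1.1, p.2.1.2), (p.1.shift p.2.1.2, p.2.1.1), (p.1, p.2.1.2)} :
      Finset (Edge d L))) :
    (∀ m : Fin d, (e.1 m).val < R) ∧ (e.1 e.2).val + 1 < R := by
  haveI : Fact (1 < L) := ⟨by omega⟩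
  obtain ⟨x, ⟨⟨i, j⟩, hij⟩⟩ := p
  obtain ⟨hbox, hi, hj⟩ := hp
  simp only at hbox hi hj he ⊢
  have hij0 : i ≠ j := ne_of_lt hij
  have hneg1 : (-1 : ZMod L).val = L - 1 := by
    obtain ⟨n, hn⟩ := Nat.exists_eq_succ_of_ne_zero (NeZero.ne L)
    subst hn
    rw [ZMod.val_neg_one, Nat.succ_sub_one]
  have hne1 : ∀ c : ZMod L, c.val + 1 < R → c ≠ -1 := by
    intro c hc h
    rw [h, hneg1] at hc
    omega
  have hval : ∀ c : ZMod L, c.val + 1 < R → (c + 1).val = c.val + 1 :=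
    fun c hc => val_add_one_of_ne_neg_one (by omega) (hne1 c hc)
  have hsh : ∀ (k m : Fin d), (x.shift k) m = if m = k then x k + 1 else x m := by
    intro k m
    by_cases h : m = k
    · subst h; simp [Site.shift]
    · simp [Site.shift, h]
  simp only [Finset.mem_insert, Finset.mem_singleton] at he
  rcases he with rfl | rfl | rfl | rfl
  · exact ⟨hbox, hi⟩
  · refine ⟨fun m => ?_, ?_⟩
    · show ((x.shift i) m).val < R
      rw [hsh]
      split_ifs with h
      · rw [hval _ hi]; exact hi
      · exact hbox m
    · show ((x.shift i) j).val + 1 < R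
      rw [hsh, if_neg (Ne.symm hij0)]
      exact hj
  · refine ⟨fun m => ?_, ?_⟩
    · show ((x.shift j) m).val < R
      rw [hsh]
      split_ifs with h
      · rw [hval _ hj]; exact hj
      · exact hbox m
    · show ((x.shift j) i).val + 1 < R
      rw [hsh, if_neg hij0]
      exact hi
  · exact ⟨hbox, hj⟩

/-- **A torus Morse plaquette whose top link is a box link lies in the box** (`R + 1 ≤ L`): the top link
`(x + e_i, j)` resp. `(x + e_j, i)` in the box forces every coordinate of `x` below `R` with room above
`x_i`, `x_j` — and excludes the wrapped case `x_i = −1`. [ours] -/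
theorem morse_mem_box_of_topLink (hRL : R + 1 ≤ L) (p : Plaquette d L)
    (hlink : (∀ m : Fin d, (((fun p : Plaquette d L => if p.1 p.2.1.1 = -1 then (p.1.shift p.2.1.2, p.2.1.1)
        else (p.1.shift p.2.1.1, p.2.1.2)) p).1 m).val < R) ∧
      (((fun p : Plaquette d L => if p.1 p.2.1.1 = -1 then (p.1.shift p.2.1.2, p.2.1.1)
        else (p.1.shift p.2.1.1, p.2.1.2)) p).1 ((fun p : Plaquette d L => if p.1 p.2.1.1 = -1 then
          (p.1.shift p.2.1.2, p.2.1.1) else (p.1.shift p.2.1.1, p.2.1.2)) p).2).val + 1 < R) :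
    (∀ m : Fin d, (p.1 m).val < R) ∧ (p.1 p.2.1.1).val + 1 < R ∧ (p.1 p.2.1.2).val + 1 < R := by
  haveI : Fact (1 < L) := ⟨by omega⟩
  obtain ⟨x, ⟨⟨i, j⟩, hij⟩⟩ := p
  simp only at hlink ⊢
  have hij0 : i ≠ j := ne_of_lt hij
  have hsh : ∀ (k m : Fin d), (x.shift k) m = if m = k then x k + 1 else x m := by
    intro k m
    by_cases h : m = k
    · subst h; simp [Site.shift]
    · simp [Site.shift, h]
  have hneg1 : (-1 : ZMod L).val = L - 1 := by
    obtain ⟨n, hn⟩ := Nat.exists_eq_succ_of_ne_zero (NeZero.ne L)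
    subst hn
    rw [ZMod.val_neg_one, Nat.succ_sub_one]
  by_cases hxi : x i = -1
  · -- top link `(x + e_j, i)`: its base has coordinate `i` equal to `x_i = −1`, of value `L − 1 ≥ R`
    rw [if_pos hxi] at hlink
    obtain ⟨hb, -⟩ := hlink
    have h : ((x.shift j) i).val < R := hb i
    rw [hsh, if_neg hij0, hxi, hneg1] at h
    omega
  · rw [if_neg hxi] at hlink
    obtain ⟨hb, hj⟩ := hlink
    replace hb : ∀ m, ((x.shift i) m).val < R := hb
    replace hj : ((x.shift i) j).val + 1 < R := hj
    rw [hsh, if_neg (Ne.symm hij0)] at hj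
    have hi' := hb i
    rw [hsh, if_pos rfl, val_add_one_of_ne_neg_one (by omega) hxi] at hi'
    refine ⟨fun m => ?_, hi', hj⟩
    have h := hb m
    rw [hsh] at h
    split_ifs at h with hm
    · rw [val_add_one_of_ne_neg_one (by omega) hxi] at h
      rw [hm]; omega
    · exact h

/-! ## §2 Any ranked structure in the box is completed by the Morse plaquettes outside it -/

/-- **`B ∪ (Morse ∖ K)` is ranked on the torus** for every ranked `B ⊆ K` (`L ≥ 2`, `R + 1 ≤ L`): top links
`t` on `B`, the Morse top links outside; ranks of `B` kept, Morse ranks shifted above `max_B rank`.  A Morse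
plaquette outside the box never has its top link on a box plaquette (§1), so no constraint points from the
outside part into `B`. [ours] -/
theorem ranked_union_morse_outside_box (hL : 2 ≤ L) (hRL : R + 1 ≤ L) (K : Finset (Plaquette d L))
    (hK : K = Finset.univ.filter (fun p : Plaquette d L =>
      (∀ m : Fin d, (p.1 m).val < R) ∧ (p.1 p.2.1.1).val + 1 < R ∧ (p.1 p.2.1.2).val + 1 < R))
    (BM : Finset (Plaquette d L)) (tM : Plaquette d L → Edge d L) (rM : Plaquette d L → ℕ)
    (hBM : BM = Finset.univ.filter (fun p : Plaquette d L =>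
      (∀ m : Fin d, m < p.2.1.1 → p.1 m = 0) ∧
        (p.1 p.2.1.1 ≠ -1 ∨ ((∀ m : Fin d, p.2.1.1 < m → m < p.2.1.2 → p.1 m = 0) ∧ p.1 p.2.1.2 ≠ -1))))
    (htM : tM = fun p => if p.1 p.2.1.1 = -1 then (p.1.shift p.2.1.2, p.2.1.1) else (p.1.shift p.2.1.1, p.2.1.2))
    (hrM : rM = fun p => 4 * ∑ m, (p.1 m).val + (if p.1 p.2.1.1 = -1 then 4 else 3) +
      (if p.1 p.2.1.2 = -1 then 4 else 3))
    (B : Finset (Plaquette d L)) (hBK : B ⊆ K) (t : Plaquette d L → Edge d L)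
    (ht : ∀ p ∈ B, t p ∈ ({(p.1, p.2.1.1), (p.1.shift p.2.1.1, p.2.1.2),
        (p.1.shift p.2.1.2, p.2.1.1), (p.1, p.2.1.2)} : Finset (Edge d L)))
    (rank : Plaquette d L → ℕ)
    (hrank : ∀ p ∈ B, ∀ p' ∈ B, p ≠ p' → t p ∈ ({(p'.1, p'.2.1.1), (p'.1.shift p'.2.1.1, p'.2.1.2),
        (p'.1.shift p'.2.1.2, p'.2.1.1), (p'.1, p'.2.1.2)} : Finset (Edge d L)) → rank p < rank p') :
    (∀ p ∈ B ∪ (BM \ K), (fun p => if p ∈ B then t p else tM p) p ∈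
        ({(p.1, p.2.1.1), (p.1.shift p.2.1.1, p.2.1.2), (p.1.shift p.2.1.2, p.2.1.1), (p.1, p.2.1.2)} :
          Finset (Edge d L))) ∧
    (∀ p ∈ B ∪ (BM \ K), ∀ p' ∈ B ∪ (BM \ K), p ≠ p' →
      (fun p => if p ∈ B then t p else tM p) p ∈ ({(p'.1, p'.2.1.1), (p'.1.shift p'.2.1.1, p'.2.1.2),
        (p'.1.shift p'.2.1.2, p'.2.1.1), (p'.1, p'.2.1.2)} : Finset (Edge d L)) →
      (fun p => if p ∈ B then rank p else rM p + (B.sup rank + 1)) p <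
        (fun p => if p ∈ B then rank p else rM p + (B.sup rank + 1)) p') := by
  have hMlinks : ∀ p, tM p ∈ ({(p.1, p.2.1.1), (p.1.shift p.2.1.1, p.2.1.2),
      (p.1.shift p.2.1.2, p.2.1.1), (p.1, p.2.1.2)} : Finset (Edge d L)) := fun p => morse_mem_links tM htM p
  have hMrank := morse_rank_lt hL BM tM rM hBM htM hrM
  refine ⟨fun p hp => ?_, fun p hp p' hp' hne hmem => ?_⟩
  · simp only
    split_ifs with h
    · exact ht p h
    · exact hMlinks p
  · simp only at hmem ⊢
    rcases Finset.mem_union.1 hp with hpB | hpC <;> rcases Finset.mem_union.1 hp' with hp'B | hp'C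
    · -- both in `B`
      rw [if_pos hpB] at hmem ⊢; rw [if_pos hp'B]
      exact hrank p hpB p' hp'B hne hmem
    · -- `p ∈ B`, `p'` outside: ranks of `B` are below the shift
      have hp'B : p' ∉ B := fun h => (Finset.mem_sdiff.1 hp'C).2 (hBK h)
      rw [if_pos hpB] at hmem ⊢; rw [if_neg hp'B]
      have := Finset.le_sup (f := rank) hpB
      omega
    · -- `p` outside, `p' ∈ B ⊆ K`: the Morse top link of `p` would be a box link, so `p ∈ K`
      have hpB : p ∉ B := fun h => (Finset.mem_sdiff.1 hpC).2 (hBK h)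
      rw [if_neg hpB] at hmem
      have hp'K : p' ∈ K := hBK hp'B
      rw [hK, Finset.mem_filter] at hp'K
      have hlink := mem_boxLinks_of_mem_box (d := d) hRL p' hp'K.2 hmem
      have hpK := morse_mem_box_of_topLink (d := d) hRL p (by rw [htM] at hlink; exact hlink)
      exact absurd (by rw [hK, Finset.mem_filter]; exact ⟨Finset.mem_univ _, hpK⟩) (Finset.mem_sdiff.1 hpC).2
    · -- both outside: the Morse structure is ranked, the common shift cancels
      have hpB : p ∉ B := fun h => (Finset.mem_sdiff.1 hpC).2 (hBK h)
      have hp'B : p' ∉ B := fun h => (Finset.mem_sdiff.1 hp'C).2 (hBK h)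
      rw [if_neg hpB] at hmem ⊢; rw [if_neg hp'B]
      have := hMrank p (Finset.mem_sdiff.1 hpC).1 p' (Finset.mem_sdiff.1 hp'C).1 hne hmem
      omega

/-! ## §3 The maximum in the box is the Morse structure cut to the box -/

/-- **`#B ≤ #(Morse ∩ K)` for every ranked structure `B ⊆ K`** (`L ≥ 2`, `R + 1 ≤ L`): by §2 and the homology
bound `#(B ∪ (Morse ∖ K)) ≤ (d−1)(L^d − 1) = #Morse` (`TorusRankedHomologyBound`, `card_morse`). [ours] -/
theorem card_le_card_morse_inter_box (hL : 2 ≤ L) (hRL : R + 1 ≤ L) (K : Finset (Plaquette d L))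
    (hK : K = Finset.univ.filter (fun p : Plaquette d L =>
      (∀ m : Fin d, (p.1 m).val < R) ∧ (p.1 p.2.1.1).val + 1 < R ∧ (p.1 p.2.1.2).val + 1 < R))
    (BM : Finset (Plaquette d L))
    (hBM : BM = Finset.univ.filter (fun p : Plaquette d L =>
      (∀ m : Fin d, m < p.2.1.1 → p.1 m = 0) ∧
        (p.1 p.2.1.1 ≠ -1 ∨ ((∀ m : Fin d, p.2.1.1 < m → m < p.2.1.2 → p.1 m = 0) ∧ p.1 p.2.1.2 ≠ -1))))
    (B : Finset (Plaquette d L)) (hBK : B ⊆ K) (t : Plaquette d L → Edge d L)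
    (ht : ∀ p ∈ B, t p ∈ ({(p.1, p.2.1.1), (p.1.shift p.2.1.1, p.2.1.2),
        (p.1.shift p.2.1.2, p.2.1.1), (p.1, p.2.1.2)} : Finset (Edge d L)))
    (rank : Plaquette d L → ℕ)
    (hrank : ∀ p ∈ B, ∀ p' ∈ B, p ≠ p' → t p ∈ ({(p'.1, p'.2.1.1), (p'.1.shift p'.2.1.1, p'.2.1.2),
        (p'.1.shift p'.2.1.2, p'.2.1.1), (p'.1, p'.2.1.2)} : Finset (Edge d L)) → rank p < rank p') :
    B.card ≤ (BM ∩ K).card := by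
  classical
  obtain ⟨ht', hrank'⟩ := ranked_union_morse_outside_box hL hRL K hK BM _ _ hBM rfl rfl B hBK t ht rank hrank
  have hH := card_add_card_site_add_le_card_edge_add_one_of_ranked hL (B ∪ (BM \ K)) _ ht' _ hrank'
  have hcardM := card_morse hL BM hBM
  rw [Summit.Ventures.LatticeQCDFlow.Runbook.card_site, Summit.Ventures.LatticeQCDFlow.Runbook.card_edge] at hH
  have hdisj : Disjoint B (BM \ K) := by
    rw [Finset.disjoint_left]
    intro p hp hp'
    exact (Finset.mem_sdiff.1 hp').2 (hBK hp)
  rw [Finset.card_union_of_disjoint hdisj] at hH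
  have hsplit : (BM \ K).card + (BM ∩ K).card = BM.card := by
    rw [← Finset.card_union_of_disjoint (Finset.disjoint_sdiff_inter BM K), Finset.sdiff_union_inter]
  have hX : 1 ≤ L ^ d := Nat.one_le_pow _ _ (by omega)
  -- `#links + 1 − #sites − d = (d−1)(L^d − 1) = #Morse`
  have hkey : L ^ d * d + 1 = (d - 1) * (L ^ d - 1) + L ^ d + d := by
    rcases Nat.eq_zero_or_pos d with hd | hd
    · subst hd; simp
    · obtain ⟨e, rfl⟩ : ∃ e, d = e + 1 := ⟨d - 1, by omega⟩
      obtain ⟨Y, hY⟩ : ∃ Y, L ^ (e + 1) = Y + 1 := ⟨L ^ (e + 1) - 1, by omega⟩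
      rw [hY, Nat.add_sub_cancel, Nat.add_sub_cancel]
      ring
  omega

/-- **The Morse structure cut to the box is a ranked structure inside the box** (sub-family of a ranked
family; its top links are links of its plaquettes). [ours] -/
theorem morse_inter_box_ranked (hL : 2 ≤ L) (K BM : Finset (Plaquette d L)) (tM : Plaquette d L → Edge d L)
    (rM : Plaquette d L → ℕ)
    (hBM : BM = Finset.univ.filter (fun p : Plaquette d L =>
      (∀ m : Fin d, m < p.2.1.1 → p.1 m = 0) ∧
        (p.1 p.2.1.1 ≠ -1 ∨ ((∀ m : Fin d, p.2.1.1 < m → m < p.2.1.2 → p.1 m = 0) ∧ p.1 p.2.1.2 ≠ -1))))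
    (htM : tM = fun p => if p.1 p.2.1.1 = -1 then (p.1.shift p.2.1.2, p.2.1.1) else (p.1.shift p.2.1.1, p.2.1.2))
    (hrM : rM = fun p => 4 * ∑ m, (p.1 m).val + (if p.1 p.2.1.1 = -1 then 4 else 3) +
      (if p.1 p.2.1.2 = -1 then 4 else 3)) :
    (BM ∩ K) ⊆ K ∧
    (∀ p ∈ BM ∩ K, tM p ∈ ({(p.1, p.2.1.1), (p.1.shift p.2.1.1, p.2.1.2),
        (p.1.shift p.2.1.2, p.2.1.1), (p.1, p.2.1.2)} : Finset (Edge d L))) ∧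
    (∀ p ∈ BM ∩ K, ∀ p' ∈ BM ∩ K, p ≠ p' → tM p ∈ ({(p'.1, p'.2.1.1), (p'.1.shift p'.2.1.1, p'.2.1.2),
        (p'.1.shift p'.2.1.2, p'.2.1.1), (p'.1, p'.2.1.2)} : Finset (Edge d L)) → rM p < rM p') :=
  ⟨Finset.inter_subset_right, fun p _ => morse_mem_links tM htM p,
    fun p hp p' hp' hne hmem => morse_rank_lt hL BM tM rM hBM htM hrM p (Finset.mem_inter.1 hp).1 p'
      (Finset.mem_inter.1 hp').1 hne hmem⟩

/-- **THE LARGEST RANKED STRUCTURE INSIDE A BOX IS THE MORSE STRUCTURE CUT TO THE BOX** (`L ≥ 2`,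
`R + 1 ≤ L`, every `d`): `#(Morse ∩ K)` is the greatest cardinality of a ranked structure `B ⊆ K`. [ours] -/
theorem isGreatest_card_ranked_box (hL : 2 ≤ L) (hRL : R + 1 ≤ L) (K : Finset (Plaquette d L))
    (hK : K = Finset.univ.filter (fun p : Plaquette d L =>
      (∀ m : Fin d, (p.1 m).val < R) ∧ (p.1 p.2.1.1).val + 1 < R ∧ (p.1 p.2.1.2).val + 1 < R))
    (BM : Finset (Plaquette d L))
    (hBM : BM = Finset.univ.filter (fun p : Plaquette d L =>
      (∀ m : Fin d, m < p.2.1.1 → p.1 m = 0) ∧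
        (p.1 p.2.1.1 ≠ -1 ∨ ((∀ m : Fin d, p.2.1.1 < m → m < p.2.1.2 → p.1 m = 0) ∧ p.1 p.2.1.2 ≠ -1)))) :
    IsGreatest {n : ℕ | ∃ (B : Finset (Plaquette d L)) (t : Plaquette d L → Edge d L)
      (rank : Plaquette d L → ℕ), B ⊆ K ∧
      (∀ p ∈ B, t p ∈ ({(p.1, p.2.1.1), (p.1.shift p.2.1.1, p.2.1.2),
        (p.1.shift p.2.1.2, p.2.1.1), (p.1, p.2.1.2)} : Finset (Edge d L))) ∧
      (∀ p ∈ B, ∀ p' ∈ B, p ≠ p' → t p ∈ ({(p'.1, p'.2.1.1), (p'.1.shift p'.2.1.1, p'.2.1.2),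
        (p'.1.shift p'.2.1.2, p'.2.1.1), (p'.1, p'.2.1.2)} : Finset (Edge d L)) → rank p < rank p') ∧
      B.card = n} (BM ∩ K).card := by
  obtain ⟨hsub, htM, hrM⟩ := morse_inter_box_ranked hL K BM _ _ hBM rfl rfl
  refine ⟨⟨BM ∩ K, _, _, hsub, htM, hrM, rfl⟩, ?_⟩
  rintro n ⟨B, t, rank, hBK, ht, hrank, rfl⟩
  exact card_le_card_morse_inter_box hL hRL K hK BM hBM B hBK t ht rank hrank

/-- **THE LEAST NUMBER OF BOX PLAQUETTES OUTSIDE A RANKED STRUCTURE INSIDE THE BOX IS EXACTLY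
`#(K ∖ Morse)`** (`L ≥ 2`, `R + 1 ≤ L`, every `d`) — counted in `BoxRankedMorseCount`: `(R−1)³` in three
dimensions (one plaquette per unit cube), `0` in two (free-boundary exactness). [ours] -/
theorem isLeast_card_compl_ranked_box (hL : 2 ≤ L) (hRL : R + 1 ≤ L) (K : Finset (Plaquette d L))
    (hK : K = Finset.univ.filter (fun p : Plaquette d L =>
      (∀ m : Fin d, (p.1 m).val < R) ∧ (p.1 p.2.1.1).val + 1 < R ∧ (p.1 p.2.1.2).val + 1 < R))
    (BM : Finset (Plaquette d L))
    (hBM : BM = Finset.univ.filter (fun p : Plaquette d L =>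
      (∀ m : Fin d, m < p.2.1.1 → p.1 m = 0) ∧
        (p.1 p.2.1.1 ≠ -1 ∨ ((∀ m : Fin d, p.2.1.1 < m → m < p.2.1.2 → p.1 m = 0) ∧ p.1 p.2.1.2 ≠ -1)))) :
    IsLeast {k : ℕ | ∃ (B : Finset (Plaquette d L)) (t : Plaquette d L → Edge d L)
      (rank : Plaquette d L → ℕ), B ⊆ K ∧
      (∀ p ∈ B, t p ∈ ({(p.1, p.2.1.1), (p.1.shift p.2.1.1, p.2.1.2),
        (p.1.shift p.2.1.2, p.2.1.1), (p.1, p.2.1.2)} : Finset (Edge d L))) ∧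
      (∀ p ∈ B, ∀ p' ∈ B, p ≠ p' → t p ∈ ({(p'.1, p'.2.1.1), (p'.1.shift p'.2.1.1, p'.2.1.2),
        (p'.1.shift p'.2.1.2, p'.2.1.1), (p'.1, p'.2.1.2)} : Finset (Edge d L)) → rank p < rank p') ∧
      (K \ B).card = k} (K \ BM).card := by
  obtain ⟨hsub, htM, hrM⟩ := morse_inter_box_ranked hL K BM _ _ hBM rfl rfl
  have hKM : (K \ (BM ∩ K)).card = (K \ BM).card := by
    congr 1; ext p; simp only [Finset.mem_sdiff, Finset.mem_inter]; tauto
  refine ⟨⟨BM ∩ K, _, _, hsub, htM, hrM, hKM⟩, ?_⟩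
  rintro k ⟨B, t, rank, hBK, ht, hrank, rfl⟩
  have hle := card_le_card_morse_inter_box hL hRL K hK BM hBM B hBK t ht rank hrank
  have h1 : (K \ B).card = K.card - B.card := Finset.card_sdiff_of_subset hBK
  have h2 : (K \ BM).card = K.card - (BM ∩ K).card := by
    rw [← hKM]; exact Finset.card_sdiff_of_subset Finset.inter_subset_right
  have h3 : (BM ∩ K).card ≤ K.card := Finset.card_le_card Finset.inter_subset_right
  omega

end Summit.Ventures.LatticeQCDFlow.Theory2.Autoregressive
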